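import Mathlib

/-!
# Self-converse gadgets contain honest designs — the explicit star
# (crux `PrimeTwoFamilies`, stmt-MatrixMultiplication-14308, line `Sketch`, stub `stub_honestOfSelfConverse`)

Siege attempt k14 (variation: explicit / elementary), an independent proof of the registered stub
(the tree's `CapacityLift.stub_honestOfSelfConverse` proves the same signature; this file shares no code
with it and is organised around ONE star lemma with a symmetric "confusable" hypothesis plus a
two-monomial exponent bookkeeping).  The stub is proved verbatim over Mathlib primitives only: the gadget
and SDPP clauses are inlined exactly as in the registered signature; there is no lift, no transfer to
another modulus and no new definition.  The honest family produced lives in the SAME `ℤ/m` as the gadget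
and consists of `π`-images of letters of the gadget.

## Vocabulary (all inlined below)
A *gadget* is a list `(P c, Q c)_{c<r}` of DIRECT pairs of finite subsets of an abelian group
(`(x - x') + (y - y') = 0 → x = x' ∧ y = y'` inside one pair) with a map `π` on the letters such that every
ordered pair of distinct letters `(σ, τ)` is *strongly separated* — every cross difference `y - x`
(`x ∈ P σ`, `y ∈ Q τ`) differs from every diagonal difference `y' - x'` (`x' ∈ P c`, `y' ∈ Q c`) — either
directly or after `π`.  Call `(σ, τ)` *confusable* if it is NOT strongly separated directly.

## The argument
* STAR LEMMA (`honest_of_star`): if the letters `e 0, …, e (n-1)` are pairwise distinct and pairwise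
  confusable, the gadget axiom forces every ordered pair of their `π`-images to be strongly separated,
  and that is exactly clause (X) for the family `(P (π (e i)), Q (π (e i)))_{i<n}`; clause (W) is the
  directness of the letters `π (e i)`.  So the `π`-image of a confusable star is an honest SDPP family.
* Letters sharing a point on one side are pairwise confusable: a shared `Q`-point `y` makes the cross
  difference `y - x` (`x ∈ P σ`) a diagonal difference of `σ`; a shared `P`-point `x` makes `y - x`
  (`y ∈ Q τ`) a diagonal difference of `τ`.
* POPULAR POINT (`exists_popular_point`, double counting): some point of `ℤ/m` lies on the chosen side of
  at least `(∑_c |S c|) / m` letters.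
* BOOKKEEPING in the two monomials `a = m^{1/2-ε}` (the target) and `b = m^{ε/4}`: use the hypothesis at
  `ε/2` with `m ≥ ⌈2^{4/ε}⌉₊`, so that `b ≥ 2`, `m^{1-ε/2} = a²b⁶` and `m = a²b⁸` (`key`: every monomial
  `a^p b^q` is one real power of `m`, so all remaining steps are polynomial inequalities).  Every letter
  has co-volume `≥ a²b⁶`, hence a side of size `≥ a b³`; so the larger of the two side-sums is
  `≥ r·a b³/2 ≥ a³b⁹/2`, and a popular point of that side lies on `n` letters with
  `a²b⁸·n = m·n ≥ a³b⁹/2`, i.e. `2n ≥ a b ≥ 2a`.  Co-volumes of the family are those of letters,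
  `≥ m^{1-ε/2} ≥ m^{1-ε}`.
-/

-- single-conjunct summit: the mandated namespace repeats `MatrixMultiplication`.
set_option linter.dupNamespace false

namespace Summit.MatrixMultiplication.MatrixMultiplication.Theorems.PrimeTwoFamilies.CapacityLift.SiegeK14

open Finset

/-- **Star lemma.**  In a gadget of direct pairs `(P c, Q c)` (`hD`) whose ordered pairs of distinct
letters are strongly separated directly or after `π` (`hπ`), let `e : Fin n → Fin r` pick letters that are
pairwise distinct and pairwise CONFUSABLE (`he`: for `i ≠ k` some cross difference `y - x`, `x ∈ P (e i)`,
`y ∈ Q (e k)`, coincides with a diagonal difference `y' - x'`, `x' ∈ P c`, `y' ∈ Q c`).  Then the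
`π`-images `(P (π (e i)), Q (π (e i)))_{i<n}` satisfy clauses (W) and (X) of the simultaneous double
product property verbatim (an honest SDPP family): (W) is directness of the letter `π (e i)`, and in (X)
the relation `(a - a') + (b - b') = 0` says that the cross difference `b' - a` towards `π (e k)` equals the
diagonal difference `b - a'` of the letter `π (e j)`, which the separation of `(π (e i), π (e k))` forbids
unless `i = k`. -/
theorem honest_of_star {K : Type*} [AddCommGroup K] {r n : ℕ} (P Q : Fin r → Finset K)
    (hD : ∀ c : Fin r, ∀ x ∈ P c, ∀ x' ∈ P c, ∀ y ∈ Q c, ∀ y' ∈ Q c,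
      (x - x') + (y - y') = 0 → x = x' ∧ y = y')
    (π : Fin r → Fin r)
    (hπ : ∀ σ τ : Fin r, σ ≠ τ →
      (∀ x ∈ P σ, ∀ y ∈ Q τ, ∀ c : Fin r, ∀ x' ∈ P c, ∀ y' ∈ Q c, y - x ≠ y' - x') ∨
      (∀ x ∈ P (π σ), ∀ y ∈ Q (π τ), ∀ c : Fin r, ∀ x' ∈ P c, ∀ y' ∈ Q c, y - x ≠ y' - x'))
    (e : Fin n → Fin r)
    (he : ∀ i k : Fin n, i ≠ k → e i ≠ e k ∧
      ∃ x ∈ P (e i), ∃ y ∈ Q (e k), ∃ c : Fin r, ∃ x' ∈ P c, ∃ y' ∈ Q c, y - x = y' - x') :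
    (∀ i : Fin n, ∀ a ∈ P (π (e i)), ∀ a' ∈ P (π (e i)), ∀ b ∈ Q (π (e i)), ∀ b' ∈ Q (π (e i)),
        (a - a') + (b - b') = 0 → a = a' ∧ b = b') ∧
    (∀ i j k : Fin n, ∀ a ∈ P (π (e i)), ∀ a' ∈ P (π (e j)), ∀ b ∈ Q (π (e j)), ∀ b' ∈ Q (π (e k)),
        (a - a') + (b - b') = 0 → i = k) := by
  refine ⟨fun i => hD (π (e i)), fun i j k a ha a' ha' b hb b' hb' h0 => ?_⟩
  by_contra hik
  obtain ⟨hne, x, hx, y, hy, c, x', hx', y', hy', hxy⟩ := he i k hik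
  rcases hπ (e i) (e k) hne with hs | hs
  · exact hs x hx y hy c x' hx' y' hy' hxy
  · refine hs a ha b' hb' (π (e j)) a' ha' b hb ?_
    have h1 : (b - a') - (b' - a) = 0 := by rw [← h0]; abel
    exact (sub_eq_zero.1 h1).symm

/-- **Popular point** (double counting): for a family `S : Fin r → Finset α` of subsets of a finite
nonempty type, some point `y` lies in at least the average number of members:
`∑_c |S c| ≤ |α| · #{c : y ∈ S c}`. -/
theorem exists_popular_point {α : Type*} [Fintype α] [DecidableEq α] [Nonempty α] {r : ℕ}
    (S : Fin r → Finset α) :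
    ∃ y : α, ∑ c, (S c).card ≤ Fintype.card α * (univ.filter fun c : Fin r => y ∈ S c).card := by
  obtain ⟨y, -, hy⟩ := exists_max_image (univ : Finset α)
    (fun z => (univ.filter fun c : Fin r => z ∈ S c).card) univ_nonempty
  refine ⟨y, ?_⟩
  calc ∑ c, (S c).card = ∑ c : Fin r, ∑ z : α, (if z ∈ S c then 1 else 0) := by
        refine sum_congr rfl fun c _ => ?_
        rw [sum_boole, Nat.cast_id, filter_univ_mem]
    _ = ∑ z : α, ∑ c : Fin r, (if z ∈ S c then 1 else 0) := sum_comm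
    _ = ∑ z : α, (univ.filter fun c : Fin r => z ∈ S c).card := by
        refine sum_congr rfl fun z _ => ?_
        rw [sum_boole, Nat.cast_id]
    _ ≤ ∑ _z : α, (univ.filter fun c : Fin r => y ∈ S c).card :=
        sum_le_sum fun z _ => hy z (mem_univ z)
    _ = Fintype.card α * (univ.filter fun c : Fin r => y ∈ S c).card := by
        rw [sum_const, card_univ, smul_eq_mul]

/-- **Self-converse gadgets contain honest designs** (registered stub `stub_honestOfSelfConverse` of line
`Sketch`, crux stmt-MatrixMultiplication-14308, verbatim): if for every `ε > 0` there are arbitrarily large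
`m`, a gadget of `r ≥ m^{1-ε}` direct pairs `(P c, Q c)` in `ℤ/m` of co-volume `|P c|·|Q c| ≥ m^{1-ε}` and a
map `π` under which every ordered pair of distinct letters is strongly separated directly or after `π`,
then for every `ε > 0` there are arbitrarily large `m` and an honest SDPP family ((W) ∧ (X) verbatim) of
`n ≥ m^{1/2-ε}` pairs in `ℤ/m`, each of co-volume `≥ m^{1-ε}`.

Proof (explicit star): apply the hypothesis at `ε/2` above `max m₀ 1` and `⌈2^{4/ε}⌉₊`; write
`a = m^{1/2-ε}`, `b = m^{ε/4} ≥ 2`, so `m^{1-ε/2} = a²b⁶` and `m = a²b⁸`.  Each letter has a side of size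
`≥ a b³` (else its co-volume is `< a²b⁶`), so `∑_c (|P c| + |Q c|) ≥ r a b³ ≥ a³b⁹`; take the side `S`
with the larger sum (`≥ a³b⁹/2`) and a popular point `y` of it (`exists_popular_point`): the `n` letters
containing `y` on side `S` satisfy `m n ≥ a³b⁹/2`, i.e. `2n ≥ a b ≥ 2a`.  They are pairwise confusable
(shared point), so by `honest_of_star` their `π`-images are the required family; co-volumes are those
of letters, `≥ m^{1-ε/2} ≥ m^{1-ε}`. -/
theorem stub_honestOfSelfConverse
    (h : ∀ ε : ℝ, 0 < ε → ∀ m₀ : ℕ, ∃ m ≥ m₀, ∃ r : ℕ, ∃ P Q : Fin r → Finset (ZMod m),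
      ∃ π : Fin r → Fin r,
        (∀ c : Fin r, ∀ x ∈ P c, ∀ x' ∈ P c, ∀ y ∈ Q c, ∀ y' ∈ Q c,
            (x - x') + (y - y') = 0 → x = x' ∧ y = y') ∧
        (∀ σ τ : Fin r, σ ≠ τ →
            (∀ x ∈ P σ, ∀ y ∈ Q τ, ∀ c : Fin r, ∀ x' ∈ P c, ∀ y' ∈ Q c, y - x ≠ y' - x') ∨
            (∀ x ∈ P (π σ), ∀ y ∈ Q (π τ), ∀ c : Fin r, ∀ x' ∈ P c, ∀ y' ∈ Q c, y - x ≠ y' - x')) ∧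
        (m : ℝ) ^ (1 - ε) ≤ (r : ℝ) ∧
        ∀ c : Fin r, (m : ℝ) ^ (1 - ε) ≤ (((P c).card * (Q c).card : ℕ) : ℝ)) :
    ∀ ε : ℝ, 0 < ε → ∀ m₀ : ℕ, ∃ m ≥ m₀, ∃ n : ℕ, ∃ A B : Fin n → Finset (ZMod m),
      (∀ i : Fin n, ∀ a ∈ A i, ∀ a' ∈ A i, ∀ b ∈ B i, ∀ b' ∈ B i,
          (a - a') + (b - b') = 0 → a = a' ∧ b = b') ∧
      (∀ i j k : Fin n, ∀ a ∈ A i, ∀ a' ∈ A j, ∀ b ∈ B j, ∀ b' ∈ B k,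
          (a - a') + (b - b') = 0 → i = k) ∧
      (m : ℝ) ^ (1 / 2 - ε) ≤ (n : ℝ) ∧
      ∀ i : Fin n, (m : ℝ) ^ (1 - ε) ≤ (((A i).card * (B i).card : ℕ) : ℝ) := by
  intro ε hε m₀
  obtain ⟨m, hm, r, P, Q, π, hD, hπ, hr, hcov⟩ :=
    h (ε / 2) (half_pos hε) (max (max m₀ 1) ⌈(2 : ℝ) ^ (4 / ε)⌉₊)
  simp only [ge_iff_le, max_le_iff] at hm
  obtain ⟨⟨hm₀, hm1⟩, hmc⟩ := hm
  haveI : NeZero m := ⟨by omega⟩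
  have hm0 : (0 : ℝ) < m := by exact_mod_cast hm1
  have hm1' : (1 : ℝ) ≤ m := by exact_mod_cast hm1
  -- the two monomials `a = m^{1/2-ε}` (the target) and `b = m^{ε/4} ≥ 2`
  obtain ⟨a, ha⟩ : ∃ a : ℝ, a = (m : ℝ) ^ (1 / 2 - ε) := ⟨_, rfl⟩
  obtain ⟨b, hb⟩ : ∃ b : ℝ, b = (m : ℝ) ^ (ε / 4) := ⟨_, rfl⟩
  have ha0 : 0 < a := ha ▸ Real.rpow_pos_of_pos hm0 _
  have hb0 : 0 < b := hb ▸ Real.rpow_pos_of_pos hm0 _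
  have key : ∀ p q : ℕ, a ^ p * b ^ q = (m : ℝ) ^ ((1 / 2 - ε) * p + ε / 4 * q) := by
    intro p q
    rw [ha, hb, Real.rpow_add hm0, Real.rpow_mul hm0.le, Real.rpow_mul hm0.le, Real.rpow_natCast,
      Real.rpow_natCast]
  have hm_eq : (m : ℝ) = a ^ 2 * b ^ 8 := by
    rw [key]
    conv_lhs => rw [← Real.rpow_one (m : ℝ)]
    congr 1; push_cast; ring
  have hmid : (m : ℝ) ^ (1 - ε / 2) = a ^ 2 * b ^ 6 := by
    rw [key]; congr 1; push_cast; ring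
  have hb2 : 2 ≤ b := by
    have h2 : (2 : ℝ) ^ (4 / ε) ≤ (m : ℝ) := (Nat.le_ceil _).trans (by exact_mod_cast hmc)
    calc (2 : ℝ) = ((2 : ℝ) ^ (4 / ε)) ^ (ε / 4) := by
          rw [← Real.rpow_mul (by norm_num : (0 : ℝ) ≤ 2),
            show 4 / ε * (ε / 4) = (1 : ℝ) by field_simp, Real.rpow_one]
      _ ≤ b := hb ▸ Real.rpow_le_rpow (by positivity) h2 (by positivity)
  -- every letter has co-volume `≥ a²b⁶`, hence is nonempty on both sides and has a side `≥ a b³`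
  have hcov2 : ∀ c, a ^ 2 * b ^ 6 ≤ ((P c).card : ℝ) * ((Q c).card : ℝ) := fun c => by
    rw [← hmid]; exact_mod_cast hcov c
  have hpos : ∀ c, (0 : ℝ) < ((P c).card : ℝ) * ((Q c).card : ℝ) := fun c =>
    lt_of_lt_of_le (by positivity) (hcov2 c)
  have hPne : ∀ c, (P c).Nonempty := fun c =>
    Finset.card_pos.1 (Nat.pos_of_ne_zero fun h0 => by have := hpos c; simp [h0] at this)
  have hQne : ∀ c, (Q c).Nonempty := fun c =>
    Finset.card_pos.1 (Nat.pos_of_ne_zero fun h0 => by have := hpos c; simp [h0] at this)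
  have hside : ∀ c, a * b ^ 3 ≤ ((P c).card : ℝ) + ((Q c).card : ℝ) := by
    intro c
    by_contra hlt
    push Not at hlt
    have hP0 : (0 : ℝ) ≤ ((P c).card : ℝ) := Nat.cast_nonneg _
    have hQ0 : (0 : ℝ) ≤ ((Q c).card : ℝ) := Nat.cast_nonneg _
    have h1 : ((P c).card : ℝ) * ((Q c).card : ℝ) < (a * b ^ 3) * (a * b ^ 3) :=
      mul_lt_mul'' (by linarith) (by linarith) hP0 hQ0
    have h2 : (a * b ^ 3) * (a * b ^ 3) = a ^ 2 * b ^ 6 := by ring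
    linarith [hcov2 c]
  have hsum : (r : ℝ) * (a * b ^ 3) ≤ ∑ c, ((P c).card : ℝ) + ∑ c, ((Q c).card : ℝ) := by
    rw [← sum_add_distrib]
    have := Finset.sum_le_sum fun c (_ : c ∈ (univ : Finset (Fin r))) => hside c
    simpa only [sum_const, card_univ, Fintype.card_fin, nsmul_eq_mul] using this
  -- the side with the larger sum; its stars are confusable
  obtain ⟨S, hS2, hSconf⟩ : ∃ S : Fin r → Finset (ZMod m),
      (∑ c, ((P c).card : ℝ) + ∑ c, ((Q c).card : ℝ)) ≤ 2 * ∑ c, ((S c).card : ℝ) ∧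
      ∀ (z : ZMod m) (σ τ : Fin r), z ∈ S σ → z ∈ S τ →
        ∃ x ∈ P σ, ∃ y ∈ Q τ, ∃ c : Fin r, ∃ x' ∈ P c, ∃ y' ∈ Q c, y - x = y' - x' := by
    by_cases hc : ∑ c, ((P c).card : ℝ) ≤ ∑ c, ((Q c).card : ℝ)
    · refine ⟨Q, by linarith, fun z σ τ hσ hτ => ?_⟩
      obtain ⟨x, hx⟩ := hPne σ
      exact ⟨x, hx, z, hτ, σ, x, hx, z, hσ, rfl⟩
    · refine ⟨P, by push Not at hc; linarith, fun z σ τ hσ hτ => ?_⟩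
      obtain ⟨y, hy⟩ := hQne τ
      exact ⟨z, hσ, y, hy, τ, z, hτ, y, hy, rfl⟩
  -- a popular point of that side and its star
  obtain ⟨y, hy⟩ := exists_popular_point S
  rw [ZMod.card] at hy
  obtain ⟨T, hT⟩ : ∃ T : Finset (Fin r), T = univ.filter fun c : Fin r => y ∈ S c := ⟨_, rfl⟩
  rw [← hT] at hy
  have hTS : ∀ c ∈ T, y ∈ S c := fun c hc => by
    rw [hT, mem_filter] at hc
    exact hc.2
  let e : Fin T.card ↪o Fin r := T.orderEmbOfFin rfl
  have hyS : ∀ i, y ∈ S (e i) := fun i => hTS (e i) (T.orderEmbOfFin_mem rfl i)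
  obtain ⟨hW, hX⟩ := honest_of_star P Q hD π hπ e fun i k hik =>
    ⟨fun h' => hik (e.injective h'), hSconf y (e i) (e k) (hyS i) (hyS k)⟩
  refine ⟨m, hm₀, T.card, fun i => P (π (e i)), fun i => Q (π (e i)), hW, hX, ?_, fun i => ?_⟩
  · -- `a ≤ n`: `a b · a²b⁸ = a²b⁶ · a b³ ≤ r · a b³ ≤ 2 m n = 2 n · a²b⁸`, and `b ≥ 2`
    have hy' : (∑ c, ((S c).card : ℝ)) ≤ (m : ℝ) * (T.card : ℝ) := by exact_mod_cast hy
    have hr' : a ^ 2 * b ^ 6 ≤ (r : ℝ) := by rw [← hmid]; exact hr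
    have h1 : a * b * (a ^ 2 * b ^ 8) ≤ 2 * (T.card : ℝ) * (a ^ 2 * b ^ 8) :=
      calc a * b * (a ^ 2 * b ^ 8) = (a ^ 2 * b ^ 6) * (a * b ^ 3) := by ring
        _ ≤ (r : ℝ) * (a * b ^ 3) := mul_le_mul_of_nonneg_right hr' (by positivity)
        _ ≤ 2 * ((m : ℝ) * (T.card : ℝ)) := by linarith
        _ = 2 * (T.card : ℝ) * (a ^ 2 * b ^ 8) := by rw [hm_eq]; ring
    have h2 : a * b ≤ 2 * (T.card : ℝ) := le_of_mul_le_mul_right h1 (by positivity)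
    rw [← ha]
    nlinarith [mul_le_mul_of_nonneg_left hb2 ha0.le]
  · -- co-volumes are those of letters
    exact (Real.rpow_le_rpow_of_exponent_le hm1' (by linarith)).trans (hcov (π (e i)))

end Summit.MatrixMultiplication.MatrixMultiplication.Theorems.PrimeTwoFamilies.CapacityLift.SiegeK14
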